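import Literature.Computability.QuantumComplexity.SketchNormConcentration
import Literature.Probability.Moments.McDiarmidWeighted
import Mathlib.Analysis.Matrix.Normed
import Mathlib.Analysis.Complex.ExponentialBounds
import HarnessLib

/-!
# Matrix multiplication by subsampling with exponentially small failure (CGLLTW 2022 §3.2/§5.2)

Chia, Gilyén, Li, Lin, Tang, Wang, J. ACM 69(5):33 (2022) = arXiv:1910.06151 (numbering of the
held arXiv text).  §5.2, before Lemma "Matrix multiplication by subsampling": "Drineas, Kannan, and
Mahoney use a concentration inequality to prove tighter error bounds for approximating matrix
multiplication. We state their result in a slightly stronger form, which is actually proved in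
their paper. For completeness, a proof of this statement is in the appendix."

> **Lemma (Matrix multiplication by subsampling [DKM06]).** Suppose we are given `A ∈ ℂ^{n×m}`,
> `B ∈ ℂ^{n×p}`, `c ∈ ℤ⁺` and a distribution `p ∈ ℝ^n` satisfying the oversampling condition
> that, for some `φ ≥ 1`, `p(k) ≥ ‖A(k,·)‖‖B(k,·)‖ / (φ Σ_ℓ ‖A(ℓ,·)‖‖B(ℓ,·)‖)`. Let `S ∈ ℝ^{c×n}`
> be sampled according to `p`. Then `A†S†SB` is an unbiased estimator for `A†B` and
> `Pr[ ‖A†S†SB − A†B‖_F < √(8φ² log(2/δ)/c) · Σ_k ‖A(k,·)‖‖B(k,·)‖ ] > 1 − δ`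
> (and `Σ_k ‖A(k,·)‖‖B(k,·)‖ ≤ ‖A‖_F‖B‖_F`).

and its corollary, §3.2 "the key lemma we use most in Section 6":

> **Lemma (Approximating matrix multiplication to Frobenius norm error; corollary of [DKM06]).**
> Consider `X ∈ ℂ^{m×n}`, `Y ∈ ℂ^{m×p}`, and take `S ∈ ℝ^{s×m}` to be sampled according to
> `r := (p+q)/2`, where `p, q ∈ ℝ^m` are `φ₁,φ₂`-oversampled importance sampling distributions
> from `X, Y`, respectively. Then `S` is a `2φ₁, 2φ₂`-oversampled importance sampling sketch of
> `X, Y`, respectively. Further,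
> `Pr[ ‖X†S†SY − X†Y‖_F < √(8φ₁φ₂ log(2/δ)/s) ‖X‖_F‖Y‖_F ] > 1 − δ`.

The printed proof (§7 "Deferred proofs", held text p. 47) is followed step by step:
(1) `E‖A†S†SB − A†B‖_F² ≤ (φ/c)(Σ_k ‖A(k,·)‖‖B(k,·)‖)²` (`iid_frobSq_sub_le_of_joint`, from the
exact DKM06 Lemma 4 identity `iid_frobSq_sub` of `ApproxMatrixProduct.lean`); (2) "by Jensen's
inequality" `E f ≤ √(E f²) ≤ √(φ/c) Σ` for `f(i₁,…,i_c) := ‖A†B − Σ_s A(i_s,·)†B(i_s,·)/(c p(i_s))‖_F`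
(`iid_mean_sqrt_le`, `iid_mean_err_le`); (3) "suppose that the index sequences `i⃗` and `i⃗'`
only differ at the `s`-th position. Then by the triangle inequality
`|f(i⃗) − f(i⃗')| ≤ (2/c) max_k ‖A(k,·)†B(k,·)/p(k)‖_F ≤ 2φΣ/c`" (`err_update_sub_le`, via the
Frobenius norm of Mathlib, `open scoped Matrix.Norms.Frobenius`, and `norm_eq_sqrt_frobSq`);
(4) McDiarmid's "independent bounded difference inequality" (the paper's Lemma 7.1 =
[McDiarmid1989, Lemma (1.2)], in tree as `Literature.Probability.Moments.mcdiarmid_upper`) with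
`γ = √(2φ² log(2/δ)/c) Σ`, and `√(φ/c) + √(2φ² log(2/δ)/c) ≤ √(8φ² log(2/δ)/c)`
(`subsampled_matrix_product`); (5) the corollary by "the inequality of arithmetic and geometric
means" (`isOversampledDist_avg_left/right`, `joint_oversampling_avg`, `approx_matrix_product`).

Conventions as in `ApproxMatrixProduct.lean`: real entries (`-- TODO(general form): ℂ`), `c = s`
samples `ω : Fin s → Fin m` with law `iidWeight p ω`, `A = X`, `B = Y` with ROWS `X k`, so `A†B` is
`Xᵀ * Y` and `A†S†SB = (SX)ᵀ(SY)`; `‖M‖_F = √(frobSq M)` in statements.  The oversampling condition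
is written multiplied out, `‖X(k,·)‖‖Y(k,·)‖ ≤ φ Σ p(k)` (equivalent for `Σ > 0`, which the
printed condition presupposes by dividing by `Σ`; for `Σ = 0` the estimator is exact and the
printed strict event `‖·‖_F < 0` is empty, so `Σ > 0` is a genuine hypothesis of the first lemma,
while the corollary is proved for all `X, Y`).  We prove the failure mass `≤ δ/2` (the printed
proof spends `δ` on the two-sided McDiarmid bound but uses one side), which gives the printed
`> 1 − δ`.  No named facts; everything stated is proved.

## References
* [ChiaEtAl2022] N.-H. Chia, A. Gilyén, T. Li, H.-H. Lin, E. Tang, C. Wang, J. ACM 69(5):33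
  (2022) = arXiv:1910.06151 — §3.2 Lemma "Approximating matrix multiplication to Frobenius norm
  error" (held text p. 18), §5.2 Lemma "Matrix multiplication by subsampling [DKM06]" (p. 36),
  §7 its proof and Lemma 7.1 (McDiarmid) (p. 47).
* [DrineasKannanMahoney2006] P. Drineas, R. Kannan, M. W. Mahoney, SIAM J. Comput. 36(1)
  (2006) 132–157, Theorem 1 (the concentration form of the basic matrix multiplication algorithm).
* [McDiarmid1989] C. McDiarmid, *On the method of bounded differences*, Lemma (1.2) — in tree:
  `Literature/Probability/Moments/McDiarmidWeighted.lean`.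
-/

noncomputable section

namespace Literature.Computability.QuantumComplexity

namespace SampleQuery

open Finset Real Literature.Probability.Moments

open scoped Matrix Matrix.Norms.Frobenius

variable {m n q s : ℕ}

/-! ### The Frobenius norm of Mathlib and the file's `frobSq` -/

/-- `‖M‖_F = √(Σ_{ij} M_{ij}²)`: Mathlib's Frobenius norm is the square root of `frobSq`.
[cite: ChiaEtAl2022, §2.1 (notation `‖·‖_F`)] -/
theorem norm_eq_sqrt_frobSq (M : Matrix (Fin n) (Fin q) ℝ) : ‖M‖ = Real.sqrt (frobSq M) := by
  rw [Matrix.frobenius_norm_def, Real.sqrt_eq_rpow, frobSq_eq_sum_sq]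
  congr 1
  refine sum_congr rfl fun i _ => sum_congr rfl fun j _ => ?_
  rw [Real.rpow_two, Real.norm_eq_abs, sq_abs]

/-- `Σ_k ‖X(k,·)‖‖Y(k,·)‖ ≤ ‖X‖_F‖Y‖_F` (Cauchy–Schwarz; the under-brace of the printed lemma).
[cite: ChiaEtAl2022, §5.2 Lemma "Matrix multiplication by subsampling" (`≤ ‖A‖_F‖B‖_F`)] -/
theorem sum_rowNorms_mul_le (X : Matrix (Fin m) (Fin n) ℝ) (Y : Matrix (Fin m) (Fin q) ℝ) :
    ∑ k, rowNorms X k * rowNorms Y k ≤ Real.sqrt (frobSq X) * Real.sqrt (frobSq Y) := by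
  have hcs := Finset.sum_mul_sq_le_sq_mul_sq (Finset.univ : Finset (Fin m)) (rowNorms X) (rowNorms Y)
  simp only [rowNorms_sq] at hcs
  have h0 : 0 ≤ ∑ k, rowNorms X k * rowNorms Y k :=
    sum_nonneg fun k _ => mul_nonneg (Real.sqrt_nonneg _) (Real.sqrt_nonneg _)
  rw [← Real.sqrt_mul (frobSq_nonneg X), ← Real.sqrt_sq h0]
  exact Real.sqrt_le_sqrt (by simpa [frobSq] using hcs)

/-! ### The joint oversampling condition and the second moment -/

section joint

variable {φ : ℝ} {p : Fin m → ℝ} {X : Matrix (Fin m) (Fin n) ℝ} {Y : Matrix (Fin m) (Fin q) ℝ}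

/-- `‖X(k,·)‖‖Y(k,·)‖ = 0` means row `k` of `X` or of `Y` vanishes. [cite: ChiaEtAl2022, §5.2
Lemma "Matrix multiplication by subsampling" (terms with `‖A(k,·)‖‖B(k,·)‖ = 0`)] -/
theorem row_eq_zero_of_rowNorms_mul_eq_zero {k : Fin m} (h0 : rowNorms X k * rowNorms Y k = 0) :
    X k = 0 ∨ Y k = 0 := by
  rcases mul_eq_zero.1 h0 with h | h
  · left; unfold rowNorms at h
    exact (normSq_eq_zero_iff _).1 ((Real.sqrt_eq_zero (normSq_nonneg _)).1 h)
  · right; unfold rowNorms at h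
    exact (normSq_eq_zero_iff _).1 ((Real.sqrt_eq_zero (normSq_nonneg _)).1 h)

/-- If every index carries a zero row of `X` or of `Y` (`Σ_k ‖X(k,·)‖‖Y(k,·)‖ = 0`), the estimator
is exact: `(SX)ᵀ(SY) − XᵀY = 0` (both vanish). [cite: ChiaEtAl2022, §5.2 Lemma "Matrix
multiplication by subsampling" (degenerate case of the oversampling condition)] -/
theorem sketchProd_sub_eq_zero_of_rows (hp0 : ∀ k, 0 ≤ p k) (h : ∀ k, X k = 0 ∨ Y k = 0)
    (ω : Fin s → Fin m) : (sketch p ω * X)ᵀ * (sketch p ω * Y) - Xᵀ * Y = 0 := by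
  ext i j
  have hk : ∀ k, X k i * Y k j = 0 := fun k => by rcases h k with h0 | h0 <;> simp [h0]
  simp only [Matrix.sub_apply, Matrix.zero_apply, sketch_transpose_mul_sketch hp0, Matrix.mul_apply,
    Matrix.transpose_apply, outerEst, hk, zero_div, sum_const_zero, sub_zero]

/-- Under the joint oversampling condition, an index of mass zero carries a zero row of `X` or of
`Y` (so the estimator stays unbiased). [cite: ChiaEtAl2022, §5.2 Lemma "Matrix multiplication by
subsampling" (oversampling condition)] -/
theorem row_eq_zero_of_joint
    (hov : ∀ k, rowNorms X k * rowNorms Y k ≤ φ * (∑ l, rowNorms X l * rowNorms Y l) * p k)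
    {k : Fin m} (hk : p k = 0) : X k = 0 ∨ Y k = 0 := by
  have h0 : rowNorms X k * rowNorms Y k = 0 := by
    have := hov k
    rw [hk, mul_zero] at this
    exact le_antisymm this (mul_nonneg (Real.sqrt_nonneg _) (Real.sqrt_nonneg _))
  exact row_eq_zero_of_rowNorms_mul_eq_zero h0

/-- **Unbiasedness** under the joint condition: `E[(SX)ᵀ(SY)] = XᵀY` entrywise ("`A†S†SB` is an
unbiased estimator for `A†B`"). [cite: ChiaEtAl2022, §5.2 Lemma "Matrix multiplication by
subsampling" (first conclusion) and §7 its proof (first display)] -/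
theorem iid_mean_sketchProd_of_joint (hp0 : ∀ k, 0 ≤ p k) (hp1 : ∑ k, p k = 1)
    (hov : ∀ k, rowNorms X k * rowNorms Y k ≤ φ * (∑ l, rowNorms X l * rowNorms Y l) * p k)
    (hs : s ≠ 0) (i : Fin n) (j : Fin q) :
    ∑ ω : Fin s → Fin m, iidWeight p ω * ((sketch p ω * X)ᵀ * (sketch p ω * Y)) i j
      = (Xᵀ * Y) i j :=
  iid_mean_sketchProd hp0 hp1 (fun _ hk => row_eq_zero_of_joint hov hk) hs i j

/-- **Second moment under the joint condition**:
`E‖(SX)ᵀ(SY) − XᵀY‖_F² ≤ (φ/s)(Σ_k ‖X(k,·)‖‖Y(k,·)‖)²` (printed chain ending in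
"`≤ (1/c) Σ_k (φ Σ_ℓ ‖A(ℓ,·)‖‖B(ℓ,·)‖ / (‖A(k,·)‖‖B(k,·)‖)) ‖A(k,·)‖²‖B(k,·)‖² = (φ/c)(Σ_k …)²`").
[cite: ChiaEtAl2022, §7, proof of Lemma "Matrix multiplication by subsampling" (second display)] -/
theorem iid_frobSq_sub_le_of_joint (hp0 : ∀ k, 0 ≤ p k) (hp1 : ∑ k, p k = 1) (hφ : 0 ≤ φ)
    (hov : ∀ k, rowNorms X k * rowNorms Y k ≤ φ * (∑ l, rowNorms X l * rowNorms Y l) * p k)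
    (hs : s ≠ 0) :
    ∑ ω : Fin s → Fin m, iidWeight p ω * frobSq ((sketch p ω * X)ᵀ * (sketch p ω * Y) - Xᵀ * Y)
      ≤ φ / s * (∑ k, rowNorms X k * rowNorms Y k) ^ 2 := by
  set T : ℝ := ∑ l, rowNorms X l * rowNorms Y l with hT
  have hT0 : 0 ≤ T := sum_nonneg fun k _ => mul_nonneg (Real.sqrt_nonneg _) (Real.sqrt_nonneg _)
  have hs' : (0 : ℝ) < s := Nat.cast_pos.2 (Nat.pos_of_ne_zero hs)
  rw [iid_frobSq_sub hp0 hp1 (fun _ hk => row_eq_zero_of_joint hov hk) hs]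
  have hterm : ∀ k, normSq (X k) * normSq (Y k) / p k ≤ rowNorms X k * rowNorms Y k * (φ * T) := by
    intro k
    have ha : 0 ≤ rowNorms X k * rowNorms Y k :=
      mul_nonneg (Real.sqrt_nonneg _) (Real.sqrt_nonneg _)
    rw [normSq_mul_normSq_eq_sq]
    rcases (hp0 k).eq_or_lt with h0 | hpos
    · rw [← h0, div_zero]; exact mul_nonneg ha (mul_nonneg hφ hT0)
    · rw [div_le_iff₀ hpos]
      calc (rowNorms X k * rowNorms Y k) ^ 2
          = (rowNorms X k * rowNorms Y k) * (rowNorms X k * rowNorms Y k) := sq _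
        _ ≤ (rowNorms X k * rowNorms Y k) * (φ * T * p k) := mul_le_mul_of_nonneg_left (hov k) ha
        _ = rowNorms X k * rowNorms Y k * (φ * T) * p k := by ring
  have hsum : ∑ k, normSq (X k) * normSq (Y k) / p k ≤ φ * T ^ 2 := by
    calc ∑ k, normSq (X k) * normSq (Y k) / p k ≤ ∑ k, rowNorms X k * rowNorms Y k * (φ * T) :=
          sum_le_sum fun k _ => hterm k
      _ = φ * T ^ 2 := by rw [← sum_mul, ← hT]; ring
  calc ((∑ k, normSq (X k) * normSq (Y k) / p k) - frobSq (Xᵀ * Y)) / s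
      ≤ (φ * T ^ 2) / s :=
        div_le_div_of_nonneg_right (by linarith [frobSq_nonneg (Xᵀ * Y)]) hs'.le
    _ = φ / s * T ^ 2 := by ring

/-! ### Jensen: `E f ≤ √(E f²)` -/

/-- **Jensen / Cauchy–Schwarz for the mean of a square root**: `E √g ≤ √(E g)` under the i.i.d.
law ("by Jensen's inequality, `E[f] ≤ √(E[‖A†S†SB − A†B‖_F²])`").
[cite: ChiaEtAl2022, §7, proof of Lemma "Matrix multiplication by subsampling" (Jensen step)] -/
theorem iid_mean_sqrt_le (hp0 : ∀ k, 0 ≤ p k) (hp1 : ∑ k, p k = 1)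
    (g : (Fin s → Fin m) → ℝ) (hg : ∀ ω, 0 ≤ g ω) :
    ∑ ω : Fin s → Fin m, iidWeight p ω * Real.sqrt (g ω)
      ≤ Real.sqrt (∑ ω : Fin s → Fin m, iidWeight p ω * g ω) := by
  have hW : ∀ ω : Fin s → Fin m, 0 ≤ iidWeight p ω := iidWeight_nonneg hp0
  have hL : 0 ≤ ∑ ω : Fin s → Fin m, iidWeight p ω * Real.sqrt (g ω) :=
    sum_nonneg fun ω _ => mul_nonneg (hW ω) (Real.sqrt_nonneg _)
  have hcs := Finset.sum_mul_sq_le_sq_mul_sq (Finset.univ : Finset (Fin s → Fin m))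
    (fun ω => Real.sqrt (iidWeight p ω)) (fun ω => Real.sqrt (iidWeight p ω) * Real.sqrt (g ω))
  have h1 : ∀ ω : Fin s → Fin m, Real.sqrt (iidWeight p ω) *
      (Real.sqrt (iidWeight p ω) * Real.sqrt (g ω)) = iidWeight p ω * Real.sqrt (g ω) := by
    intro ω; rw [← mul_assoc, Real.mul_self_sqrt (hW ω)]
  have h2 : ∀ ω : Fin s → Fin m, Real.sqrt (iidWeight p ω) ^ 2 = iidWeight p ω :=
    fun ω => Real.sq_sqrt (hW ω)
  have h3 : ∀ ω : Fin s → Fin m, (Real.sqrt (iidWeight p ω) * Real.sqrt (g ω)) ^ 2 =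
      iidWeight p ω * g ω := by
    intro ω; rw [mul_pow, Real.sq_sqrt (hW ω), Real.sq_sqrt (hg ω)]
  simp only [h1, h2, h3, sum_iidWeight hp1, one_mul] at hcs
  rw [← Real.sqrt_sq hL]
  exact Real.sqrt_le_sqrt hcs

/-- **Mean error**: `E‖(SX)ᵀ(SY) − XᵀY‖_F ≤ √(φ/s) Σ_k ‖X(k,·)‖‖Y(k,·)‖`.
[cite: ChiaEtAl2022, §7, proof of Lemma "Matrix multiplication by subsampling" ("by Jensen's
inequality … `≤ √(φ/c) Σ_k ‖A(k,·)‖‖B(k,·)‖`")] -/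
theorem iid_mean_err_le (hp0 : ∀ k, 0 ≤ p k) (hp1 : ∑ k, p k = 1) (hφ : 0 ≤ φ)
    (hov : ∀ k, rowNorms X k * rowNorms Y k ≤ φ * (∑ l, rowNorms X l * rowNorms Y l) * p k)
    (hs : s ≠ 0) :
    ∑ ω : Fin s → Fin m, iidWeight p ω *
        Real.sqrt (frobSq ((sketch p ω * X)ᵀ * (sketch p ω * Y) - Xᵀ * Y))
      ≤ Real.sqrt (φ / s) * ∑ k, rowNorms X k * rowNorms Y k := by
  have hT0 : 0 ≤ ∑ k, rowNorms X k * rowNorms Y k :=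
    sum_nonneg fun k _ => mul_nonneg (Real.sqrt_nonneg _) (Real.sqrt_nonneg _)
  refine (iid_mean_sqrt_le hp0 hp1 _ fun ω => frobSq_nonneg _).trans ?_
  rw [← Real.sqrt_sq hT0, ← Real.sqrt_mul (div_nonneg hφ (Nat.cast_nonneg _))]
  exact Real.sqrt_le_sqrt (iid_frobSq_sub_le_of_joint hp0 hp1 hφ hov hs)

/-! ### Bounded differences of `f(ω) = ‖(SX)ᵀ(SY) − XᵀY‖_F` -/

/-- `‖X(k,·)ᵀY(k,·)/p(k)‖_F² = ‖X(k,·)‖²‖Y(k,·)‖²/p(k)²`. [cite: ChiaEtAl2022, §7, proof of Lemma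
"Matrix multiplication by subsampling" (`‖A(k,·)†B(k,·)/p(k)‖_F`)] -/
theorem frobSq_outerEst (X : Matrix (Fin m) (Fin n) ℝ) (Y : Matrix (Fin m) (Fin q) ℝ)
    (p : Fin m → ℝ) (k : Fin m) :
    frobSq (outerEst X Y p k) = normSq (X k) * normSq (Y k) / p k ^ 2 := by
  rw [frobSq_eq_sum_sq]
  unfold normSq
  simp only [outerEst, div_pow, mul_pow]
  rw [Finset.sum_mul_sum, Finset.sum_div]
  refine sum_congr rfl fun i _ => ?_
  rw [Finset.sum_div]

/-- `‖X(k,·)ᵀY(k,·)/p(k)‖_F ≤ φ Σ_ℓ ‖X(ℓ,·)‖‖Y(ℓ,·)‖` under the joint condition ("`max_k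
‖A(k,·)†B(k,·)/p(k)‖_F ≤ φ Σ_k ‖A(k,·)‖‖B(k,·)‖`"). [cite: ChiaEtAl2022, §7, proof of Lemma
"Matrix multiplication by subsampling" (third display)] -/
theorem sqrt_frobSq_outerEst_le (hp0 : ∀ k, 0 ≤ p k) (hφ : 0 ≤ φ)
    (hov : ∀ k, rowNorms X k * rowNorms Y k ≤ φ * (∑ l, rowNorms X l * rowNorms Y l) * p k)
    (k : Fin m) :
    Real.sqrt (frobSq (outerEst X Y p k)) ≤ φ * ∑ l, rowNorms X l * rowNorms Y l := by
  have hT0 : 0 ≤ ∑ l, rowNorms X l * rowNorms Y l :=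
    sum_nonneg fun k _ => mul_nonneg (Real.sqrt_nonneg _) (Real.sqrt_nonneg _)
  have ha : 0 ≤ rowNorms X k * rowNorms Y k := mul_nonneg (Real.sqrt_nonneg _) (Real.sqrt_nonneg _)
  rw [frobSq_outerEst, normSq_mul_normSq_eq_sq]
  rcases (hp0 k).eq_or_lt with h0 | hpos
  · rw [← h0]; simp [mul_nonneg hφ hT0]
  · rw [← div_pow, Real.sqrt_sq (div_nonneg ha hpos.le), div_le_iff₀ hpos]
    exact hov k

/-- Resampling one index changes the estimator by one rescaled outer product:
`(SX)ᵀ(SY)|_ω − (SX)ᵀ(SY)|_{ω[t₀ ↦ k']} = (X(ω_{t₀},·)ᵀY(ω_{t₀},·)/p − X(k',·)ᵀY(k',·)/p)/s`.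
[cite: ChiaEtAl2022, §7, proof of Lemma "Matrix multiplication by subsampling" ("suppose that the
index sequences `i⃗` and `i⃗'` only differ at the `s`-th position")] -/
theorem sketchProd_sub_sketchProd_update (hp0 : ∀ k, 0 ≤ p k) (ω : Fin s → Fin m) (t₀ : Fin s)
    (k' : Fin m) :
    (sketch p ω * X)ᵀ * (sketch p ω * Y) -
        (sketch p (Function.update ω t₀ k') * X)ᵀ * (sketch p (Function.update ω t₀ k') * Y)
      = (1 / (s : ℝ)) • (outerEst X Y p (ω t₀) - outerEst X Y p k') := by
  ext i j
  simp only [Matrix.sub_apply, Matrix.smul_apply, smul_eq_mul, sketch_transpose_mul_sketch hp0]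
  have h1 : ∑ t, outerEst X Y p (ω t) i j =
      outerEst X Y p (ω t₀) i j + ∑ t ∈ univ.erase t₀, outerEst X Y p (ω t) i j :=
    (Finset.add_sum_erase _ _ (mem_univ t₀)).symm
  have h2 : ∑ t, outerEst X Y p (Function.update ω t₀ k' t) i j =
      outerEst X Y p k' i j + ∑ t ∈ univ.erase t₀, outerEst X Y p (ω t) i j := by
    rw [← Finset.add_sum_erase _ _ (mem_univ t₀), Function.update_self]
    congr 1
    refine sum_congr rfl fun t ht => ?_
    rw [Function.update_of_ne (ne_of_mem_erase ht)]
  rw [h1, h2]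
  ring

/-- **Bounded differences**: resampling one index changes `f(ω) = ‖(SX)ᵀ(SY) − XᵀY‖_F` by at
most `2φΣ/s` ("by the triangle inequality, `|f(i⃗) − f(i⃗')| ≤ (1/c)‖A(i_s,·)†B(i_s,·)/p(i_s) −
A(i'_s,·)†B(i'_s,·)/p(i'_s)‖_F ≤ (2/c) max_k ‖A(k,·)†B(k,·)/p(k)‖_F ≤ (2φ/c) Σ_k ‖A(k,·)‖‖B(k,·)‖`").
[cite: ChiaEtAl2022, §7, proof of Lemma "Matrix multiplication by subsampling" (third display)] -/
theorem err_update_sub_le (hp0 : ∀ k, 0 ≤ p k) (hφ : 0 ≤ φ)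
    (hov : ∀ k, rowNorms X k * rowNorms Y k ≤ φ * (∑ l, rowNorms X l * rowNorms Y l) * p k)
    (ω : Fin s → Fin m) (t₀ : Fin s) (k₁ k₂ : Fin m) :
    Real.sqrt (frobSq ((sketch p (Function.update ω t₀ k₁) * X)ᵀ *
          (sketch p (Function.update ω t₀ k₁) * Y) - Xᵀ * Y)) -
      Real.sqrt (frobSq ((sketch p (Function.update ω t₀ k₂) * X)ᵀ *
          (sketch p (Function.update ω t₀ k₂) * Y) - Xᵀ * Y))
      ≤ 2 * φ * (∑ l, rowNorms X l * rowNorms Y l) / s := by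
  have hs0 : (0 : ℝ) ≤ 1 / (s : ℝ) := by positivity
  have hdiff : (sketch p (Function.update ω t₀ k₁) * X)ᵀ * (sketch p (Function.update ω t₀ k₁) * Y) -
      (sketch p (Function.update ω t₀ k₂) * X)ᵀ * (sketch p (Function.update ω t₀ k₂) * Y)
        = (1 / (s : ℝ)) • (outerEst X Y p k₁ - outerEst X Y p k₂) := by
    have h := sketchProd_sub_sketchProd_update (X := X) (Y := Y) hp0 (Function.update ω t₀ k₁) t₀ k₂
    rwa [Function.update_idem, Function.update_self] at h
  rw [← norm_eq_sqrt_frobSq, ← norm_eq_sqrt_frobSq]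
  calc ‖(sketch p (Function.update ω t₀ k₁) * X)ᵀ * (sketch p (Function.update ω t₀ k₁) * Y) - Xᵀ * Y‖ -
        ‖(sketch p (Function.update ω t₀ k₂) * X)ᵀ * (sketch p (Function.update ω t₀ k₂) * Y) - Xᵀ * Y‖
      ≤ ‖((sketch p (Function.update ω t₀ k₁) * X)ᵀ * (sketch p (Function.update ω t₀ k₁) * Y) -
            Xᵀ * Y) -
          ((sketch p (Function.update ω t₀ k₂) * X)ᵀ * (sketch p (Function.update ω t₀ k₂) * Y) -
            Xᵀ * Y)‖ := norm_sub_norm_le _ _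
    _ = ‖(1 / (s : ℝ)) • (outerEst X Y p k₁ - outerEst X Y p k₂)‖ := by
        rw [sub_sub_sub_cancel_right, hdiff]
    _ = (1 / (s : ℝ)) * ‖outerEst X Y p k₁ - outerEst X Y p k₂‖ := by
        rw [norm_smul, Real.norm_eq_abs, abs_of_nonneg hs0]
    _ ≤ (1 / (s : ℝ)) * (‖outerEst X Y p k₁‖ + ‖outerEst X Y p k₂‖) :=
        mul_le_mul_of_nonneg_left (norm_sub_le _ _) hs0
    _ ≤ (1 / (s : ℝ)) * (φ * (∑ l, rowNorms X l * rowNorms Y l) +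
          φ * (∑ l, rowNorms X l * rowNorms Y l)) := by
        refine mul_le_mul_of_nonneg_left (add_le_add ?_ ?_) hs0 <;>
          rw [norm_eq_sqrt_frobSq] <;> exact sqrt_frobSq_outerEst_le hp0 hφ hov _
    _ = 2 * φ * (∑ l, rowNorms X l * rowNorms Y l) / s := by ring

/-! ### McDiarmid ⇒ the subsampling lemma -/

/-- `√(φ/s) + √(2φ² L/s) ≤ √(8φ² L/s)` for `φ ≥ 1`, `L ≥ 1/2` (the last step of the printed proof,
with `L = log(2/δ) ≥ log 2`). [cite: ChiaEtAl2022, §7, proof of Lemma "Matrix multiplication by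
subsampling" (last display)] -/
theorem sqrt_add_sqrt_le {φ L s : ℝ} (hφ : 1 ≤ φ) (hL : 1 / 2 ≤ L) (hs : 0 < s) :
    Real.sqrt (φ / s) + Real.sqrt (2 * φ ^ 2 * L / s) ≤ Real.sqrt (8 * φ ^ 2 * L / s) := by
  have h1 : Real.sqrt (φ / s) ≤ Real.sqrt (2 * φ ^ 2 * L / s) := by
    refine Real.sqrt_le_sqrt (div_le_div_of_nonneg_right ?_ hs.le)
    nlinarith
  have h2 : Real.sqrt (8 * φ ^ 2 * L / s) = 2 * Real.sqrt (2 * φ ^ 2 * L / s) := by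
    rw [show 8 * φ ^ 2 * L / s = 2 ^ 2 * (2 * φ ^ 2 * L / s) by ring,
      Real.sqrt_mul (by norm_num), Real.sqrt_sq (by norm_num)]
  rw [h2]
  linarith

/-- `log(2/δ) ≥ 1/2` for `0 < δ ≤ 1` (`log 2 = 0.693…`). [cite: ChiaEtAl2022, §7, proof of
Lemma "Matrix multiplication by subsampling" (last display, which uses `2φ log(2/δ) ≥ 1`)] -/
theorem half_le_log_two_div {δ : ℝ} (hδ : 0 < δ) (hδ1 : δ ≤ 1) : 1 / 2 ≤ Real.log (2 / δ) := by
  rw [Real.log_div (by norm_num) hδ.ne']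
  have h2 := Real.log_two_gt_d9
  have hδ' : Real.log δ ≤ 0 := Real.log_nonpos hδ.le hδ1
  linarith

/-- **CGLLTW Lemma "Matrix multiplication by subsampling [DKM06]" (= the concentration form of
DKM06 Thm. 1)**: under the joint oversampling condition with `φ ≥ 1` and `Σ = Σ_k ‖X(k,·)‖‖Y(k,·)‖
> 0`, for `0 < δ ≤ 1` the `p`-mass of the sample sequences with
`‖(SX)ᵀ(SY) − XᵀY‖_F ≥ √(8φ² log(2/δ)/s) Σ` is at most `δ/2` (the printed `Pr[‖·‖_F < …] > 1 − δ`
for every `δ > 0` is `subsampled_matrix_product'`).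
[cite: ChiaEtAl2022, §5.2 Lemma "Matrix multiplication by subsampling [DKM06]" and §7 (proof via
Lemma 7.1 = McDiarmid)]; [cite: DrineasKannanMahoney2006, Thm. 1] -/
theorem subsampled_matrix_product (hp0 : ∀ k, 0 ≤ p k) (hp1 : ∑ k, p k = 1) (hφ : 1 ≤ φ)
    (hov : ∀ k, rowNorms X k * rowNorms Y k ≤ φ * (∑ l, rowNorms X l * rowNorms Y l) * p k)
    (hTpos : 0 < ∑ l, rowNorms X l * rowNorms Y l) (hs : 0 < s) {δ : ℝ} (hδ : 0 < δ) (hδ1 : δ ≤ 1) :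
    ∑ ω ∈ univ.filter (fun ω : Fin s → Fin m =>
        Real.sqrt (8 * φ ^ 2 * Real.log (2 / δ) / s) * (∑ l, rowNorms X l * rowNorms Y l) ≤
          Real.sqrt (frobSq ((sketch p ω * X)ᵀ * (sketch p ω * Y) - Xᵀ * Y))),
      iidWeight p ω ≤ δ / 2 := by
  classical
  have hW : ∀ ω : Fin s → Fin m, 0 ≤ iidWeight p ω := iidWeight_nonneg hp0
  have hs' : (0 : ℝ) < s := Nat.cast_pos.2 hs
  have hφ0 : 0 ≤ φ := by linarith
  have hL : 1 / 2 ≤ Real.log (2 / δ) := half_le_log_two_div hδ hδ1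
  have hLpos : 0 < Real.log (2 / δ) := by linarith
  -- the mean: `E f ≤ √(φ/s) Σ`
  have hmean := iid_mean_err_le hp0 hp1 hφ0 hov hs.ne'
  -- bounded differences `2φΣ/s`
  have hbd : ∀ (ω : Fin s → Fin m) (t : Fin s) (a b : Fin m),
      Real.sqrt (frobSq ((sketch p (Function.update ω t a) * X)ᵀ *
          (sketch p (Function.update ω t a) * Y) - Xᵀ * Y)) -
        Real.sqrt (frobSq ((sketch p (Function.update ω t b) * X)ᵀ *
          (sketch p (Function.update ω t b) * Y) - Xᵀ * Y))
        ≤ (fun _ : Fin s => 2 * φ * (∑ l, rowNorms X l * rowNorms Y l) / s) t :=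
    fun ω t a b => err_update_sub_le hp0 hφ0 hov ω t a b
  -- McDiarmid, upper tail, `γ = √(2φ² log(2/δ)/s) Σ`
  have hγ0 : 0 ≤ Real.sqrt (2 * φ ^ 2 * Real.log (2 / δ) / s) * ∑ l, rowNorms X l * rowNorms Y l :=
    mul_nonneg (Real.sqrt_nonneg _) hTpos.le
  have hMc := mcdiarmid_upper (ι := Fin s) (Γ := Fin m) (w := fun _ => p)
    (F := fun ω : Fin s → Fin m =>
      Real.sqrt (frobSq ((sketch p ω * X)ᵀ * (sketch p ω * Y) - Xᵀ * Y)))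
    (fun _ => hp0) (fun _ => hp1) hbd hγ0
  have hpw : ∀ ω : Fin s → Fin m, prodWeight (fun _ : Fin s => p) ω = iidWeight p ω := fun _ => rfl
  simp only [hpw] at hMc
  -- now abbreviate
  set T : ℝ := ∑ l, rowNorms X l * rowNorms Y l with hT
  set L : ℝ := Real.log (2 / δ) with hLdef
  -- the exponent equals `log(2/δ)`, so the McDiarmid bound is `δ/2`
  have hexp : Real.exp (-(2 * (Real.sqrt (2 * φ ^ 2 * L / s) * T) ^ 2 /
      ∑ _t : Fin s, (2 * φ * T / s) ^ 2)) = δ / 2 := by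
    rw [sum_const, card_univ, Fintype.card_fin, mul_pow, Real.sq_sqrt (by positivity)]
    have : 2 * (2 * φ ^ 2 * L / s * T ^ 2) / ((s : ℕ) • (2 * φ * T / s) ^ 2) = L := by
      rw [nsmul_eq_mul]
      field_simp
    rw [this, hLdef, Real.exp_neg, Real.exp_log (by positivity), inv_div]
  rw [hexp] at hMc
  -- thresholds: `√(φ/s) T + γ ≤ √(8φ²L/s) T`
  have hthr : Real.sqrt (φ / s) * T + Real.sqrt (2 * φ ^ 2 * L / s) * T ≤
      Real.sqrt (8 * φ ^ 2 * L / s) * T := by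
    rw [← add_mul]
    exact mul_le_mul_of_nonneg_right (sqrt_add_sqrt_le hφ hL hs') hTpos.le
  refine le_trans (sum_le_sum_of_subset_of_nonneg (fun ω hω => ?_) (fun ω _ _ => hW ω)) hMc
  rw [mem_filter] at hω ⊢
  exact ⟨mem_univ _, by linarith [hω.2]⟩

/-- **The printed form**: `Pr[ ‖(SX)ᵀ(SY) − XᵀY‖_F < √(8φ² log(2/δ)/s) Σ_k ‖X(k,·)‖‖Y(k,·)‖ ]
> 1 − δ` for every `δ > 0` (joint oversampling with `φ ≥ 1`, `Σ > 0`, `s ≥ 1`).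
[cite: ChiaEtAl2022, §5.2 Lemma "Matrix multiplication by subsampling [DKM06]"] -/
theorem subsampled_matrix_product' (hp0 : ∀ k, 0 ≤ p k) (hp1 : ∑ k, p k = 1) (hφ : 1 ≤ φ)
    (hov : ∀ k, rowNorms X k * rowNorms Y k ≤ φ * (∑ l, rowNorms X l * rowNorms Y l) * p k)
    (hTpos : 0 < ∑ l, rowNorms X l * rowNorms Y l) (hs : 0 < s) {δ : ℝ} (hδ : 0 < δ) :
    1 - δ < ∑ ω ∈ univ.filter (fun ω : Fin s → Fin m =>
        Real.sqrt (frobSq ((sketch p ω * X)ᵀ * (sketch p ω * Y) - Xᵀ * Y)) <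
          Real.sqrt (8 * φ ^ 2 * Real.log (2 / δ) / s) * (∑ l, rowNorms X l * rowNorms Y l)),
      iidWeight p ω := by
  classical
  have hW : ∀ ω : Fin s → Fin m, 0 ≤ iidWeight p ω := iidWeight_nonneg hp0
  -- mass of the event = 1 − mass of its complement
  set thr : ℝ := Real.sqrt (8 * φ ^ 2 * Real.log (2 / δ) / s) * (∑ l, rowNorms X l * rowNorms Y l)
    with hthr
  set f : (Fin s → Fin m) → ℝ := fun ω =>
    Real.sqrt (frobSq ((sketch p ω * X)ᵀ * (sketch p ω * Y) - Xᵀ * Y)) with hf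
  have hsplit : ∑ ω ∈ univ.filter (fun ω : Fin s → Fin m => f ω < thr), iidWeight p ω =
      1 - ∑ ω ∈ univ.filter (fun ω : Fin s → Fin m => thr ≤ f ω), iidWeight p ω := by
    rw [eq_sub_iff_add_eq, ← sum_iidWeight (s := s) hp1]
    rw [← Finset.sum_filter_add_sum_filter_not univ (fun ω : Fin s → Fin m => f ω < thr)]
    congr 2
    ext ω
    simp only [mem_filter, mem_univ, true_and, not_lt]
  show 1 - δ < ∑ ω ∈ univ.filter (fun ω : Fin s → Fin m => f ω < thr), iidWeight p ω
  rw [hsplit]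
  rcases le_or_gt δ 1 with hδ1 | hδ1
  · have h := subsampled_matrix_product hp0 hp1 hφ hov hTpos hs hδ hδ1
    have h' : ∑ ω ∈ univ.filter (fun ω : Fin s → Fin m => thr ≤ f ω), iidWeight p ω ≤ δ / 2 := h
    linarith
  · have h' : ∑ ω ∈ univ.filter (fun ω : Fin s → Fin m => thr ≤ f ω), iidWeight p ω ≤ 1 := by
      calc _ ≤ ∑ ω, iidWeight p ω :=
            sum_le_sum_of_subset_of_nonneg (filter_subset _ _) (fun ω _ _ => hW ω)
        _ = 1 := sum_iidWeight hp1
    linarith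

end joint

/-! ### The corollary: `S` sampled according to `r = (p₁ + p₂)/2` -/

section corollary

variable {φ₁ φ₂ : ℝ} {p₁ p₂ : Fin m → ℝ} {X : Matrix (Fin m) (Fin n) ℝ} {Y : Matrix (Fin m) (Fin q) ℝ}

/-- `r = (p+q)/2` "oversamples the importance sampling distribution for `X` with constant `2φ₁`"
("notice that `2r(i) ≥ p(i)`"). [cite: ChiaEtAl2022, §3.2 Lemma "Approximating matrix
multiplication to Frobenius norm error" (first conclusion) and §5.2 its proof] -/
theorem isOversampledDist_avg_left (h₁ : IsOversampledDist φ₁ (rowNorms X) p₁)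
    (h₂ : IsOversampledDist φ₂ (rowNorms Y) p₂) :
    IsOversampledDist (2 * φ₁) (rowNorms X) (fun k => (p₁ k + p₂ k) / 2) := by
  refine ⟨fun k => ?_, ?_, fun k => ?_⟩
  · have := h₁.nonneg k; have := h₂.nonneg k; positivity
  · rw [← Finset.sum_div, sum_add_distrib, h₁.sum_eq_one, h₂.sum_eq_one]; norm_num
  · have hk := h₁.div_le k
    have hq := h₂.nonneg k
    rw [show lengthSqDist (rowNorms X) k / (2 * φ₁) = lengthSqDist (rowNorms X) k / φ₁ / 2 by ring]
    linarith

/-- Symmetrically, `r` oversamples the distribution for `Y` with constant `2φ₂` ("`2r(i) ≥ q(i)`").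
[cite: ChiaEtAl2022, §3.2 Lemma "Approximating matrix multiplication to Frobenius norm error"
(first conclusion) and §5.2 its proof] -/
theorem isOversampledDist_avg_right (h₁ : IsOversampledDist φ₁ (rowNorms X) p₁)
    (h₂ : IsOversampledDist φ₂ (rowNorms Y) p₂) :
    IsOversampledDist (2 * φ₂) (rowNorms Y) (fun k => (p₁ k + p₂ k) / 2) := by
  refine ⟨fun k => ?_, ?_, fun k => ?_⟩
  · have := h₁.nonneg k; have := h₂.nonneg k; positivity
  · rw [← Finset.sum_div, sum_add_distrib, h₁.sum_eq_one, h₂.sum_eq_one]; norm_num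
  · have hk := h₂.div_le k
    have hp := h₁.nonneg k
    rw [show lengthSqDist (rowNorms Y) k / (2 * φ₂) = lengthSqDist (rowNorms Y) k / φ₂ / 2 by ring]
    linarith

/-- **The joint condition for `r` by AM–GM**: `‖X(k,·)‖‖Y(k,·)‖ ≤ √(φ₁φ₂) ‖X‖_F‖Y‖_F · r(k)`,
i.e. `r` satisfies the oversampling condition of the subsampling lemma with
`φ = √(φ₁φ₂)‖X‖_F‖Y‖_F / Σ_ℓ ‖X(ℓ,·)‖‖Y(ℓ,·)‖` ("using the inequality of arithmetic and geometric
means"). [cite: ChiaEtAl2022, §5.2, proof of Lemma "Approximating matrix multiplication to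
Frobenius norm error"] -/
theorem joint_oversampling_avg (h₁ : IsOversampledDist φ₁ (rowNorms X) p₁)
    (h₂ : IsOversampledDist φ₂ (rowNorms Y) p₂) (hφ₁ : 0 < φ₁) (hφ₂ : 0 < φ₂) (k : Fin m) :
    rowNorms X k * rowNorms Y k ≤
      Real.sqrt (φ₁ * φ₂) * (Real.sqrt (frobSq X) * Real.sqrt (frobSq Y)) * ((p₁ k + p₂ k) / 2) := by
  have hx := h₁.normSq_row_le hφ₁ k
  have hy := h₂.normSq_row_le hφ₂ k
  have hp := h₁.nonneg k
  have hq := h₂.nonneg k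
  have hFX := frobSq_nonneg X
  have hFY := frobSq_nonneg Y
  -- `a_k = √(‖X_k‖²‖Y_k‖²) ≤ √(φ₁φ₂ ‖X‖²‖Y‖² p q) = √(φ₁φ₂)‖X‖‖Y‖ √(pq) ≤ … (p+q)/2`
  have h1 : rowNorms X k * rowNorms Y k ≤
      Real.sqrt (φ₁ * φ₂) * (Real.sqrt (frobSq X) * Real.sqrt (frobSq Y)) *
        Real.sqrt (p₁ k * p₂ k) := by
    unfold rowNorms
    rw [← Real.sqrt_mul (normSq_nonneg _), ← Real.sqrt_mul hFX, ← Real.sqrt_mul (by positivity),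
      ← Real.sqrt_mul (by positivity)]
    refine Real.sqrt_le_sqrt ?_
    calc normSq (X k) * normSq (Y k) ≤ (φ₁ * frobSq X * p₁ k) * (φ₂ * frobSq Y * p₂ k) :=
          mul_le_mul hx hy (normSq_nonneg _) (by positivity)
      _ = φ₁ * φ₂ * (frobSq X * frobSq Y) * (p₁ k * p₂ k) := by ring
  have h2 : Real.sqrt (p₁ k * p₂ k) ≤ (p₁ k + p₂ k) / 2 := by
    rw [← Real.sqrt_sq (by positivity : 0 ≤ (p₁ k + p₂ k) / 2)]
    exact Real.sqrt_le_sqrt (by nlinarith [sq_nonneg (p₁ k - p₂ k)])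
  exact h1.trans (mul_le_mul_of_nonneg_left h2 (by positivity))

/-- The row-norm vector of a nonzero matrix is nonzero. [cite: ChiaEtAl2022, Def. 2.9 with
Def. 2.7 (`SQ_φ(X)` for `X ≠ 0`)] -/
theorem rowNorms_ne_zero (hX : X ≠ 0) : rowNorms X ≠ 0 := by
  intro h
  have := normSq_rowNorms X
  rw [h, (normSq_eq_zero_iff _).2 rfl] at this
  exact (frobSq_pos hX).ne' this.symm

/-- **CGLLTW §3.2 key lemma "Approximating matrix multiplication to Frobenius norm error;
corollary of [DKM06]"**: with `S` sampled according to `r = (p₁+p₂)/2`, `p₁, p₂` being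
`φ₁, φ₂`-oversampled importance sampling distributions from `X ≠ 0`, `Y ≠ 0` (`s ≥ 1` rows), for
`0 < δ ≤ 1` the `r`-mass of `{‖(SX)ᵀ(SY) − XᵀY‖_F ≥ √(8φ₁φ₂ log(2/δ)/s) ‖X‖_F‖Y‖_F}` is at most
`δ/2` (the printed `Pr[‖·‖_F < …] > 1 − δ` for all `δ > 0` is `approx_matrix_product'`).
[cite: ChiaEtAl2022, §3.2 Lemma "Approximating matrix multiplication to Frobenius norm error;
corollary of [DKM06]" and §5.2 its proof] -/
theorem approx_matrix_product (h₁ : IsOversampledDist φ₁ (rowNorms X) p₁)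
    (h₂ : IsOversampledDist φ₂ (rowNorms Y) p₂) (hφ₁ : 0 < φ₁) (hφ₂ : 0 < φ₂) (hX : X ≠ 0)
    (hY : Y ≠ 0) (hs : 0 < s) {δ : ℝ} (hδ : 0 < δ) (hδ1 : δ ≤ 1) :
    ∑ ω ∈ univ.filter (fun ω : Fin s → Fin m =>
        Real.sqrt (8 * φ₁ * φ₂ * Real.log (2 / δ) / s) *
            (Real.sqrt (frobSq X) * Real.sqrt (frobSq Y)) ≤
          Real.sqrt (frobSq ((sketch (fun k => (p₁ k + p₂ k) / 2) ω * X)ᵀ *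
            (sketch (fun k => (p₁ k + p₂ k) / 2) ω * Y) - Xᵀ * Y))),
      iidWeight (fun k => (p₁ k + p₂ k) / 2) ω ≤ δ / 2 := by
  classical
  have hr := isOversampledDist_avg_left h₁ h₂
  have hr0 : ∀ k, 0 ≤ (p₁ k + p₂ k) / 2 := hr.nonneg
  have hr1 : ∑ k, (p₁ k + p₂ k) / 2 = 1 := hr.sum_eq_one
  have hW : ∀ ω : Fin s → Fin m, 0 ≤ iidWeight (fun k => (p₁ k + p₂ k) / 2) ω := iidWeight_nonneg hr0
  have h1φ₁ : 1 ≤ φ₁ := h₁.one_le (rowNorms_ne_zero hX) hφ₁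
  have h1φ₂ : 1 ≤ φ₂ := h₂.one_le (rowNorms_ne_zero hY) hφ₂
  have hFX : 0 < frobSq X := frobSq_pos hX
  have hFY : 0 < frobSq Y := frobSq_pos hY
  have hL : 1 / 2 ≤ Real.log (2 / δ) := half_le_log_two_div hδ hδ1
  have hT0 : 0 ≤ ∑ l, rowNorms X l * rowNorms Y l :=
    sum_nonneg fun k _ => mul_nonneg (Real.sqrt_nonneg _) (Real.sqrt_nonneg _)
  have hK : 0 < Real.sqrt (φ₁ * φ₂) * (Real.sqrt (frobSq X) * Real.sqrt (frobSq Y)) := by positivity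
  rcases hT0.eq_or_lt with hT | hT
  · -- degenerate: every index carries a zero row, the estimator is exact, the event is empty
    have hrows : ∀ k, X k = 0 ∨ Y k = 0 := fun k =>
      row_eq_zero_of_rowNorms_mul_eq_zero ((Finset.sum_eq_zero_iff_of_nonneg fun k _ =>
        mul_nonneg (Real.sqrt_nonneg _) (Real.sqrt_nonneg _)).1 hT.symm k (mem_univ k))
    have hthr : 0 < Real.sqrt (8 * φ₁ * φ₂ * Real.log (2 / δ) / s) *
        (Real.sqrt (frobSq X) * Real.sqrt (frobSq Y)) := by
      have : 0 < 8 * φ₁ * φ₂ * Real.log (2 / δ) / s := by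
        have hs' : (0 : ℝ) < s := Nat.cast_pos.2 hs
        have : 0 < Real.log (2 / δ) := by linarith
        positivity
      positivity
    have hempty : univ.filter (fun ω : Fin s → Fin m =>
        Real.sqrt (8 * φ₁ * φ₂ * Real.log (2 / δ) / s) *
            (Real.sqrt (frobSq X) * Real.sqrt (frobSq Y)) ≤
          Real.sqrt (frobSq ((sketch (fun k => (p₁ k + p₂ k) / 2) ω * X)ᵀ *
            (sketch (fun k => (p₁ k + p₂ k) / 2) ω * Y) - Xᵀ * Y))) = ∅ := by
      refine filter_eq_empty_iff.2 fun ω _ => ?_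
      rw [sketchProd_sub_eq_zero_of_rows hr0 hrows ω]
      have h0 : frobSq (0 : Matrix (Fin n) (Fin q) ℝ) = 0 := by simp [frobSq, normSq]
      rw [h0, Real.sqrt_zero, not_le]
      exact hthr
    rw [hempty, sum_empty]
    linarith
  -- `Σ > 0`: the subsampling lemma with `φ = √(φ₁φ₂)‖X‖_F‖Y‖_F/Σ`
  set T : ℝ := ∑ l, rowNorms X l * rowNorms Y l with hTdef
  set φ : ℝ := Real.sqrt (φ₁ * φ₂) * (Real.sqrt (frobSq X) * Real.sqrt (frobSq Y)) / T with hφdef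
  have hφT : φ * T = Real.sqrt (φ₁ * φ₂) * (Real.sqrt (frobSq X) * Real.sqrt (frobSq Y)) := by
    rw [hφdef]; field_simp
  have hφ1 : 1 ≤ φ := by
    rw [hφdef, le_div_iff₀ hT, one_mul]
    have h1 : T ≤ Real.sqrt (frobSq X) * Real.sqrt (frobSq Y) := sum_rowNorms_mul_le X Y
    have h2 : 1 ≤ Real.sqrt (φ₁ * φ₂) := by
      rw [← Real.sqrt_one]; exact Real.sqrt_le_sqrt (by nlinarith)
    nlinarith [mul_nonneg (Real.sqrt_nonneg (frobSq X)) (Real.sqrt_nonneg (frobSq Y))]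
  have hov : ∀ k, rowNorms X k * rowNorms Y k ≤ φ * T * ((p₁ k + p₂ k) / 2) := by
    intro k; rw [hφT]; exact joint_oversampling_avg h₁ h₂ hφ₁ hφ₂ k
  have h := subsampled_matrix_product (X := X) (Y := Y) hr0 hr1 hφ1 hov hT hs hδ hδ1
  -- identify the thresholds: `√(8φ²L/s)·Σ = √(8φ₁φ₂L/s)·‖X‖_F‖Y‖_F`
  have hφ0 : 0 ≤ φ := by linarith
  have hthr : Real.sqrt (8 * φ ^ 2 * Real.log (2 / δ) / s) * T =
      Real.sqrt (8 * φ₁ * φ₂ * Real.log (2 / δ) / s) *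
        (Real.sqrt (frobSq X) * Real.sqrt (frobSq Y)) := by
    have hL0 : 0 ≤ 8 * Real.log (2 / δ) / s := by
      have : 0 ≤ Real.log (2 / δ) := by linarith
      positivity
    rw [show 8 * φ ^ 2 * Real.log (2 / δ) / s = (8 * Real.log (2 / δ) / s) * φ ^ 2 by ring,
      Real.sqrt_mul hL0, Real.sqrt_sq hφ0, mul_assoc, hφT,
      show 8 * φ₁ * φ₂ * Real.log (2 / δ) / s = (8 * Real.log (2 / δ) / s) * (φ₁ * φ₂) by ring,
      Real.sqrt_mul hL0]
    ring
  rw [hthr] at h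
  exact h

/-- **The printed form of the key lemma**:
`Pr[ ‖(SX)ᵀ(SY) − XᵀY‖_F < √(8φ₁φ₂ log(2/δ)/s) ‖X‖_F‖Y‖_F ] > 1 − δ` for every `δ > 0`.
[cite: ChiaEtAl2022, §3.2 Lemma "Approximating matrix multiplication to Frobenius norm error;
corollary of [DKM06]"] -/
theorem approx_matrix_product' (h₁ : IsOversampledDist φ₁ (rowNorms X) p₁)
    (h₂ : IsOversampledDist φ₂ (rowNorms Y) p₂) (hφ₁ : 0 < φ₁) (hφ₂ : 0 < φ₂) (hX : X ≠ 0)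
    (hY : Y ≠ 0) (hs : 0 < s) {δ : ℝ} (hδ : 0 < δ) :
    1 - δ < ∑ ω ∈ univ.filter (fun ω : Fin s → Fin m =>
        Real.sqrt (frobSq ((sketch (fun k => (p₁ k + p₂ k) / 2) ω * X)ᵀ *
            (sketch (fun k => (p₁ k + p₂ k) / 2) ω * Y) - Xᵀ * Y)) <
          Real.sqrt (8 * φ₁ * φ₂ * Real.log (2 / δ) / s) *
            (Real.sqrt (frobSq X) * Real.sqrt (frobSq Y))),
      iidWeight (fun k => (p₁ k + p₂ k) / 2) ω := by
  classical
  have hr := isOversampledDist_avg_left h₁ h₂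
  have hW : ∀ ω : Fin s → Fin m, 0 ≤ iidWeight (fun k => (p₁ k + p₂ k) / 2) ω :=
    iidWeight_nonneg hr.nonneg
  set thr : ℝ := Real.sqrt (8 * φ₁ * φ₂ * Real.log (2 / δ) / s) *
    (Real.sqrt (frobSq X) * Real.sqrt (frobSq Y)) with hthr
  set f : (Fin s → Fin m) → ℝ := fun ω =>
    Real.sqrt (frobSq ((sketch (fun k => (p₁ k + p₂ k) / 2) ω * X)ᵀ *
      (sketch (fun k => (p₁ k + p₂ k) / 2) ω * Y) - Xᵀ * Y)) with hf
  have hsplit : ∑ ω ∈ univ.filter (fun ω : Fin s → Fin m => f ω < thr),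
      iidWeight (fun k => (p₁ k + p₂ k) / 2) ω =
      1 - ∑ ω ∈ univ.filter (fun ω : Fin s → Fin m => thr ≤ f ω),
        iidWeight (fun k => (p₁ k + p₂ k) / 2) ω := by
    rw [eq_sub_iff_add_eq, ← sum_iidWeight (s := s) hr.sum_eq_one]
    rw [← Finset.sum_filter_add_sum_filter_not univ (fun ω : Fin s → Fin m => f ω < thr)]
    congr 2
    ext ω
    simp only [mem_filter, mem_univ, true_and, not_lt]
  show 1 - δ < ∑ ω ∈ univ.filter (fun ω : Fin s → Fin m => f ω < thr),
    iidWeight (fun k => (p₁ k + p₂ k) / 2) ω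
  rw [hsplit]
  rcases le_or_gt δ 1 with hδ1 | hδ1
  · have h := approx_matrix_product h₁ h₂ hφ₁ hφ₂ hX hY hs hδ hδ1
    have h' : ∑ ω ∈ univ.filter (fun ω : Fin s → Fin m => thr ≤ f ω),
        iidWeight (fun k => (p₁ k + p₂ k) / 2) ω ≤ δ / 2 := h
    linarith
  · have h' : ∑ ω ∈ univ.filter (fun ω : Fin s → Fin m => thr ≤ f ω),
        iidWeight (fun k => (p₁ k + p₂ k) / 2) ω ≤ 1 := by
      calc _ ≤ ∑ ω, iidWeight (fun k => (p₁ k + p₂ k) / 2) ω :=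
            sum_le_sum_of_subset_of_nonneg (filter_subset _ _) (fun ω _ _ => hW ω)
        _ = 1 := sum_iidWeight hr.sum_eq_one
    linarith

end corollary

end SampleQuery

end Literature.Computability.QuantumComplexity

end
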